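import Mathlib.Analysis.Calculus.BumpFunction.FiniteDimension
import Mathlib.Analysis.SpecialFunctions.SmoothTransition
import Mathlib.Analysis.InnerProductSpace.Basic
import Mathlib.Analysis.Normed.Module.FiniteDimension
import HarnessLib

/-!
# Smooth cut-offs: modifying the coefficients of a quasilinear system off a compact set of states
# (topic `Analysis/PDE`)

Analysis/PDE support file (everything proved; no definitions, no named facts). Preliminary
reduction of the classical local existence theory for quasilinear symmetrisable hyperbolic
systems `A₀(U)∂ₜU + ∑ⱼ Aⱼ(U)∂ⱼU = 0` with coefficients smooth on an OPEN set of states `𝒪` and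
data with values in a compact `K ⊆ 𝒪` (Majda 1984, Ch. 2 §2.1, proof of Thm 2.1: "we modify the
coefficients outside a neighbourhood `G₂` of `Ḡ₁` … so that they are defined for all `u`,
`A₀ ≥ cI`, with bounded derivatives"; Dafermos 2005, §5.1, proof of Thm 5.1.1: "Fix any open
subset `ℬ` … which contains the closure of the range of `U₀` and whose closure is contained in
`𝒪`"; Taylor, *PDE III*, Ch. 16 §1). Contents:

* `exists_contDiff_cutoff_eq_one_nhds` — **smooth Urysohn cut-off in finite dimension**: for a
  compact `K` inside an open `𝒪` of a finite-dimensional real normed space there is a `C^∞`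
  function `χ : E → [0, 1]` with compact support inside `𝒪` and `χ = 1` on an open
  neighbourhood `𝒪'` of `K` (from Mathlib's `IsOpen.exists_contDiff_support_eq` and
  `Real.smoothTransition`);
* `contDiff_cutoffComb` — for such `χ` and `a` smooth on `𝒪`, the modified coefficient
  `ã(v) = χ(v) • a(v) + (1 - χ(v)) • c` is smooth on all of `E` and equals `a` on `𝒪'`
  (`cutoffComb_eq_of_eq_one`);
* `exists_forall_norm_iteratedFDeriv_cutoffComb_le` — every derivative of `ã` is bounded on `E`
  (`ã - c` has compact support);
* `inner_cutoffComb_symm`, `le_inner_cutoffComb_self` — on operator coefficients: symmetry is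
  preserved, and if `a(v)` is positive definite on `𝒪` then `ã` with `c = 1` is UNIFORMLY
  coercive, `⟪ã(v) w, w⟫ ≥ c₀‖w‖²` for all `v ∈ E` with one `c₀ > 0` (compactness of
  `tsupport χ × sphere`).

The state cut-off `χ(w) = ū + ψ(w)(w - ū)` of
`Barriers/AtomisticToContinuum/NoBVEstimatesMultiDCutoff.lean` handles a ball around one state;
here the compact set of states is arbitrary (the coefficients, not the states, are cut off).

## Mathlib / tree search

Mathlib: `IsOpen.exists_contDiff_support_eq`, `Real.smoothTransition`,
`IsCompact.exists_isMinOn`, `HasCompactSupport.iteratedFDeriv`, `iteratedFDeriv_const_of_ne`,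
`Continuous.bounded_above_of_compact_support`. Tree: `contDiff_smul_of_tsupport_subset`
(`CutoffCalculus.lean`, same ten-line argument, heavier import closure; re-proved here as
`contDiff_cutoffComb`).

## References

* A. Majda, *Compressible Fluid Flow and Systems of Conservation Laws in Several Space
  Variables*, Springer 1984, Ch. 2 §2.1, proof of Thm 2.1. [`Majda1984`]
* C. M. Dafermos, *Hyperbolic Conservation Laws in Continuum Physics*, 2nd ed., 2005, §5.1,
  proof of Thm 5.1.1. [`Dafermos2005`]
* M. E. Taylor, *Partial Differential Equations III*, 2nd ed., 2011, Ch. 16 §1.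
  [`TaylorPDEIII2011`]
-/

noncomputable section

open Set Function Filter Metric
open scoped ContDiff InnerProductSpace Topology

namespace Literature.Analysis.PDE

variable {E : Type*} [NormedAddCommGroup E] [NormedSpace ℝ E]
variable {V : Type*} [NormedAddCommGroup V] [NormedSpace ℝ V]

/-! ## A smooth Urysohn cut-off -/

/-- **Smooth Urysohn cut-off in finite dimension**: for `K` compact inside `𝒪` open there is a
`C^∞` function `χ : E → [0, 1]` with compact support contained in `𝒪`, equal to `1` on an open
set `𝒪'` with `K ⊆ 𝒪' ⊆ 𝒪`. Construction: `f ≥ 0` smooth with `support f = 𝒪 ∩ B(0, R)`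
(Mathlib), `m = min_K f > 0`, `χ = g ∘ f` with `g` a smooth transition from `0` on `(-∞, m/4]`
to `1` on `[m/2, ∞)`. [folklore] -/
theorem exists_contDiff_cutoff_eq_one_nhds [FiniteDimensional ℝ E] {O K : Set E} (hO : IsOpen O)
    (hK : IsCompact K) (hKO : K ⊆ O) :
    ∃ χ : E → ℝ, ContDiff ℝ ∞ χ ∧ HasCompactSupport χ ∧ tsupport χ ⊆ O ∧
      (∀ v, χ v ∈ Icc (0 : ℝ) 1) ∧
      ∃ O' : Set E, IsOpen O' ∧ K ⊆ O' ∧ O' ⊆ O ∧ ∀ v ∈ O', χ v = 1 := by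
  rcases K.eq_empty_or_nonempty with rfl | hne
  · refine ⟨fun _ => 0, contDiff_const, ?_, ?_, fun v => ⟨le_rfl, zero_le_one⟩, ∅, isOpen_empty,
      Subset.rfl, empty_subset _, fun v hv => hv.elim⟩
    · exact HasCompactSupport.of_support_subset_isCompact isCompact_empty (by simp)
    · simp
  -- a bounded open piece of `O` containing `K`
  obtain ⟨R, hR⟩ := hK.isBounded.subset_ball 0
  set S : Set E := O ∩ ball 0 R with hS_def
  have hS : IsOpen S := hO.inter isOpen_ball
  have hKS : K ⊆ S := fun v hv => ⟨hKO hv, hR hv⟩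
  obtain ⟨f, hfsupp, hfdiff, hfrange⟩ := hS.exists_contDiff_support_eq (n := ⊤)
  have hf0 : ∀ v, 0 ≤ f v := fun v => (hfrange (mem_range_self v)).1
  have hfc : Continuous f := hfdiff.continuous
  -- the minimum of `f` on `K` is positive
  obtain ⟨v₀, hv₀K, hv₀⟩ := hK.exists_isMinOn hne hfc.continuousOn
  set m : ℝ := f v₀ with hm_def
  have hm : 0 < m := by
    have h : v₀ ∈ support f := by rw [hfsupp]; exact hKS hv₀K
    exact lt_of_le_of_ne (hf0 v₀) (Ne.symm h)
  have hmK : ∀ v ∈ K, m ≤ f v := fun v hv => hv₀ hv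
  -- the transition function
  set g : ℝ → ℝ := fun s => Real.smoothTransition ((s - m / 4) / (m / 4)) with hg_def
  have hg : ContDiff ℝ ∞ g :=
    Real.smoothTransition.contDiff.comp ((contDiff_id.sub contDiff_const).div_const _)
  have hg0 : ∀ s, s ≤ m / 4 → g s = 0 := fun s hs =>
    Real.smoothTransition.zero_of_nonpos (div_nonpos_of_nonpos_of_nonneg (by linarith) (by linarith))
  have hg1 : ∀ s, m / 2 ≤ s → g s = 1 := fun s hs =>
    Real.smoothTransition.one_of_one_le (by rw [le_div_iff₀ (by linarith)]; linarith)
  refine ⟨g ∘ f, hg.comp hfdiff, ?_, ?_, fun v =>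
    ⟨Real.smoothTransition.nonneg _, Real.smoothTransition.le_one _⟩,
    {v | m / 2 < f v}, isOpen_lt continuous_const hfc, fun v hv => by
      show m / 2 < f v; linarith [hmK v hv], fun v hv => ?_, fun v hv => hg1 _ (le_of_lt hv)⟩
  · -- compact support: `tsupport (g ∘ f) ⊆ {m/4 ≤ f} ⊆ closedBall 0 R`
    refine HasCompactSupport.of_support_subset_isCompact (isCompact_closedBall (0 : E) R) ?_
    intro v hv
    have hv' : m / 4 < f v := by
      by_contra h
      exact hv (hg0 _ (not_lt.1 h))
    have hvS : v ∈ support f := ne_of_gt (lt_trans (by linarith) hv')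
    rw [hfsupp] at hvS
    exact ball_subset_closedBall hvS.2
  · -- `tsupport ⊆ {m/4 ≤ f} ⊆ support f ⊆ O`
    intro v hv
    have hcl : tsupport (g ∘ f) ⊆ {v | m / 4 ≤ f v} := by
      refine closure_minimal (fun w hw => ?_) (isClosed_le continuous_const hfc)
      by_contra h
      exact hw (hg0 _ (not_le.1 h).le)
    have h1 : m / 4 ≤ f v := hcl hv
    have hvS : v ∈ support f := ne_of_gt (lt_of_lt_of_le (by linarith) h1)
    rw [hfsupp] at hvS
    exact hvS.1
  · -- `O' ⊆ O`
    have hvS : v ∈ support f := ne_of_gt (lt_trans (by linarith) hv)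
    rw [hfsupp] at hvS
    exact hvS.1

/-! ## The modified coefficients `χ • a + (1 - χ) • c` -/

/-- **Modified coefficients are smooth on the whole state space**: for `χ` smooth with
`tsupport χ ⊆ 𝒪`, `𝒪` open, and `a` smooth on `𝒪`, the function
`v ↦ χ(v) • a(v) + (1 - χ(v)) • c` is `C^∞` on all of `E` (off `tsupport χ` it is locally the
constant `c`). [cite: Majda1984, Ch. 2 §2.1] -/
theorem contDiff_cutoffComb {O : Set E} (hO : IsOpen O) {χ : E → ℝ} (hχ : ContDiff ℝ ∞ χ)
    (hχO : tsupport χ ⊆ O) {a : E → V} (ha : ContDiffOn ℝ ∞ a O) (c : V) :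
    ContDiff ℝ ∞ fun v => χ v • a v + (1 - χ v) • c := by
  have h1 : ContDiff ℝ ∞ fun v => χ v • a v := by
    refine contDiff_iff_contDiffAt.2 fun x => ?_
    by_cases hx : x ∈ O
    · exact (hχ.contDiffOn.smul ha).contDiffAt (hO.mem_nhds hx)
    · have hx' : x ∉ tsupport χ := fun h => hx (hχO h)
      rw [notMem_tsupport_iff_eventuallyEq] at hx'
      have hev : (fun v => χ v • a v) =ᶠ[𝓝 x] fun _ => 0 := by
        filter_upwards [hx'] with z hz
        simp [hz]
      exact (contDiffAt_const (c := (0 : V))).congr_of_eventuallyEq hev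
  exact h1.add ((contDiff_const.sub hχ).smul contDiff_const)

omit [NormedAddCommGroup E] [NormedSpace ℝ E] in
/-- Where the cut-off is `1` the modified coefficient is the original one. [folklore] -/
theorem cutoffComb_eq_of_eq_one {χ : E → ℝ} {a : E → V} (c : V) {v : E} (hv : χ v = 1) :
    χ v • a v + (1 - χ v) • c = a v := by
  simp [hv]

omit [NormedAddCommGroup E] [NormedSpace ℝ E] in
/-- Off the support of the cut-off the modified coefficient is the constant `c`. [folklore] -/
theorem cutoffComb_eq_const_of_eq_zero {χ : E → ℝ} {a : E → V} (c : V) {v : E} (hv : χ v = 0) :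
    χ v • a v + (1 - χ v) • c = c := by
  simp [hv]

/-- **Every derivative of the modified coefficient is bounded** on the whole state space
(`ã - c = χ • (a - c)` has compact support, so each `D^m ã`, `m ≥ 1`, is continuous with compact
support, and `ã` itself is continuous and equal to `c` off a compact set).
[cite: Majda1984, Ch. 2 §2.1] -/
theorem exists_forall_norm_iteratedFDeriv_cutoffComb_le {O : Set E} (hO : IsOpen O) {χ : E → ℝ}
    (hχ : ContDiff ℝ ∞ χ) (hχc : HasCompactSupport χ) (hχO : tsupport χ ⊆ O) {a : E → V}
    (ha : ContDiffOn ℝ ∞ a O) (c : V) (m : ℕ) :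
    ∃ C, ∀ v, ‖iteratedFDeriv ℝ m (fun v => χ v • a v + (1 - χ v) • c) v‖ ≤ C := by
  set F : E → V := fun v => χ v • a v + (1 - χ v) • c with hF_def
  have hF : ContDiff ℝ ∞ F := contDiff_cutoffComb hO hχ hχO ha c
  -- `F - c` has compact support
  have hsupp : HasCompactSupport fun v => F v - c := by
    refine hχc.mono ?_
    intro v hv
    rw [mem_support] at hv ⊢
    intro h0
    exact hv (by simp [hF_def, h0])
  have hFc : ContDiff ℝ ∞ fun v => F v - c := hF.sub contDiff_const
  rcases Nat.eq_zero_or_pos m with rfl | hm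
  · -- order zero: `‖F v‖ ≤ ‖F v - c‖ + ‖c‖`
    obtain ⟨C, hC⟩ := (hFc.continuous).bounded_above_of_compact_support hsupp
    refine ⟨C + ‖c‖, fun v => ?_⟩
    rw [norm_iteratedFDeriv_zero]
    calc ‖F v‖ = ‖(F v - c) + c‖ := by rw [sub_add_cancel]
      _ ≤ ‖F v - c‖ + ‖c‖ := norm_add_le _ _
      _ ≤ C + ‖c‖ := by linarith [hC v]
  · -- positive order: the derivative of `F` is that of `F - c`, continuous with compact support
    have heq : iteratedFDeriv ℝ m F = iteratedFDeriv ℝ m fun v => F v - c := by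
      have h : (fun v => F v - c) = F + fun _ => -c := by funext v; simp [sub_eq_add_neg]
      rw [h, iteratedFDeriv_add (hF.of_le (by exact_mod_cast le_top))
        (contDiff_const.of_le (by exact_mod_cast le_top)), iteratedFDeriv_const_of_ne hm.ne',
        add_zero]
    obtain ⟨C, hC⟩ := ((hFc.continuous_iteratedFDeriv (by exact_mod_cast le_top)).norm).bounded_above_of_compact_support
      ((hsupp.iteratedFDeriv m).norm)
    refine ⟨C, fun v => ?_⟩
    rw [heq]
    simpa using hC v

/-! ## Operator coefficients: symmetry and uniform coercivity -/

section Operator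

variable {W : Type*} [NormedAddCommGroup W] [InnerProductSpace ℝ W]

omit [NormedAddCommGroup E] [NormedSpace ℝ E] in
/-- **Symmetry is preserved by the cut-off** (with a symmetric constant part `c`).
[folklore] -/
theorem inner_cutoffComb_symm {χ : E → ℝ} {a : E → (W →L[ℝ] W)} {c : W →L[ℝ] W}
    (ha : ∀ v, χ v ≠ 0 → ∀ w w' : W, ⟪a v w, w'⟫_ℝ = ⟪w, a v w'⟫_ℝ)
    (hc : ∀ w w' : W, ⟪c w, w'⟫_ℝ = ⟪w, c w'⟫_ℝ) (v : E) (w w' : W) :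
    ⟪(χ v • a v + (1 - χ v) • c) w, w'⟫_ℝ = ⟪w, (χ v • a v + (1 - χ v) • c) w'⟫_ℝ := by
  by_cases hχ : χ v = 0
  · simp [hχ, hc]
  · simp only [add_apply, smul_apply, inner_add_left,
      inner_add_right, inner_smul_left, inner_smul_right, ha v hχ, hc, RCLike.conj_to_real]

omit [NormedSpace ℝ E] in
/-- **Uniform coercivity of the cut-off symmetriser** (Majda 1984, proof of Thm 2.1:
"`A₀ ≥ cI`"). If `⟪a(v) w, w⟫ > 0` for `v ∈ 𝒪`, `w ≠ 0`, `a` is continuous on `𝒪`, `χ` takes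
values in `[0, 1]` with compact support inside `𝒪`, and `W` is finite-dimensional, then there is
`c₀ > 0` with `⟪(χ(v) a(v) + (1 - χ(v)) 1) w, w⟫ ≥ c₀ ‖w‖²` for ALL `v ∈ E`, `w ∈ W`.
[cite: Majda1984, Ch. 2 §2.1] -/
theorem le_inner_cutoffComb_self [FiniteDimensional ℝ W] {O : Set E} {χ : E → ℝ}
    (hχc : HasCompactSupport χ) (hχO : tsupport χ ⊆ O) (hχ01 : ∀ v, χ v ∈ Icc (0 : ℝ) 1)
    {a : E → (W →L[ℝ] W)} (ha : ContinuousOn a O)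
    (hpos : ∀ v ∈ O, ∀ w : W, w ≠ 0 → 0 < ⟪a v w, w⟫_ℝ) :
    ∃ c₀ : ℝ, 0 < c₀ ∧ ∀ (v : E) (w : W),
      c₀ * ‖w‖ ^ 2 ≤ ⟪(χ v • a v + (1 - χ v) • (1 : W →L[ℝ] W)) w, w⟫_ℝ := by
  -- a positive lower bound of `⟪a v w, w⟫` on `tsupport χ × sphere`
  obtain ⟨c₁, hc₁, hc₁le⟩ : ∃ c₁ : ℝ, 0 < c₁ ∧ ∀ v ∈ tsupport χ, ∀ w : W, ‖w‖ = 1 →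
      c₁ ≤ ⟪a v w, w⟫_ℝ := by
    by_cases hW : Nontrivial W
    swap
    · refine ⟨1, one_pos, fun v _ w hw => ?_⟩
      have : w = 0 := by
        have h := not_nontrivial_iff_subsingleton.1 hW
        exact Subsingleton.elim w 0
      simp [this] at hw
    rcases (tsupport χ).eq_empty_or_nonempty with hemp | hne
    · exact ⟨1, one_pos, fun v hv => by simp [hemp] at hv⟩
    have hcpt : IsCompact (tsupport χ ×ˢ sphere (0 : W) 1) := hχc.prod (isCompact_sphere 0 1)
    have hne' : (tsupport χ ×ˢ sphere (0 : W) 1).Nonempty := by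
      obtain ⟨w, hw⟩ := (NormedSpace.sphere_nonempty (E := W)).2 zero_le_one
      obtain ⟨v, hv⟩ := hne
      exact ⟨(v, w), hv, hw⟩
    have hcont : ContinuousOn (fun p : E × W => ⟪a p.1 p.2, p.2⟫_ℝ) (tsupport χ ×ˢ sphere (0 : W) 1) := by
      have h1 : ContinuousOn (fun p : E × W => a p.1) (tsupport χ ×ˢ sphere (0 : W) 1) :=
        (ha.mono hχO).comp continuousOn_fst fun p hp => hp.1
      exact ((h1.clm_apply continuousOn_snd).inner continuousOn_snd)
    obtain ⟨p₀, hp₀, hmin⟩ := hcpt.exists_isMinOn hne' hcont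
    refine ⟨⟪a p₀.1 p₀.2, p₀.2⟫_ℝ, ?_, fun v hv w hw => hmin (show (v, w) ∈ _ from ⟨hv, by simpa using hw⟩)⟩
    have hw0 : p₀.2 ≠ 0 := by
      intro h
      have := hp₀.2
      simp [h] at this
    exact hpos _ (hχO hp₀.1) _ hw0
  refine ⟨min c₁ 1, lt_min hc₁ one_pos, fun v w => ?_⟩
  -- expand the quadratic form
  have hexp : ⟪(χ v • a v + (1 - χ v) • (1 : W →L[ℝ] W)) w, w⟫_ℝ =
      χ v * ⟪a v w, w⟫_ℝ + (1 - χ v) * ‖w‖ ^ 2 := by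
    simp only [add_apply, smul_apply, one_apply_eq_self, inner_add_left, inner_smul_left,
      RCLike.conj_to_real, real_inner_self_eq_norm_sq]
  rw [hexp]
  obtain ⟨h0, h1⟩ := hχ01 v
  by_cases hw : w = 0
  · simp [hw]
  by_cases hχv : χ v = 0
  · rw [hχv]; simp only [zero_mul, zero_add, sub_zero, one_mul]
    exact mul_le_of_le_one_left (sq_nonneg _) (min_le_right _ _)
  · have hv : v ∈ tsupport χ := subset_tsupport _ hχv
    -- normalise `w`
    have hnw : 0 < ‖w‖ := norm_pos_iff.2 hw
    set u : W := ‖w‖⁻¹ • w with hu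
    have hu1 : ‖u‖ = 1 := by rw [hu, norm_smul, norm_inv, norm_norm, inv_mul_cancel₀ hnw.ne']
    have hau : c₁ ≤ ⟪a v u, u⟫_ℝ := hc₁le v hv u hu1
    have hscale : ⟪a v w, w⟫_ℝ = ‖w‖ ^ 2 * ⟪a v u, u⟫_ℝ := by
      have hwu : w = ‖w‖ • u := by rw [hu, smul_smul, mul_inv_cancel₀ hnw.ne', one_smul]
      conv_lhs => rw [hwu]
      rw [map_smul, inner_smul_left, inner_smul_right, RCLike.conj_to_real]
      ring
    rw [hscale]
    have hmin1 : min c₁ 1 ≤ c₁ := min_le_left _ _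
    have hmin2 : min c₁ 1 ≤ 1 := min_le_right _ _
    nlinarith [sq_nonneg ‖w‖, mul_nonneg h0 (sq_nonneg ‖w‖),
      mul_nonneg (sub_nonneg.2 h1) (sq_nonneg ‖w‖)]

end Operator

end Literature.Analysis.PDE

end
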